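import Literature.Analysis.FluidPDE.FourierL2Convolution
import Mathlib.MeasureTheory.Function.LpSpace.Complete
import Mathlib.MeasureTheory.Function.ConvergenceInMeasure
import Mathlib.MeasureTheory.Constructions.Polish.StronglyMeasurable
import Mathlib.MeasureTheory.Function.Floor
import Mathlib.Topology.UniformSpace.HeineCantor
import Mathlib.Analysis.Normed.Group.Bounded
import Mathlib.Analysis.SpecificLimits.Basic
import HarnessLib

/-!
# A jointly measurable version of an `H¹`-continuous Fourier-side trajectory

Support file for the discharge of `CheapNSFourierNonnegPersistence`
(`CheapNavierStokesBlowupProofs.lean`). The class `MemCheapNSClass` of the barrier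
`CheapNavierStokesBlowup` describes the Fourier-side unknown `U : ℝ → ℝ³ → ℂ` *slice by slice*:
each `U(t, ·)` is measurable, `t ↦ U(t, ·)` is continuous on `[0,1]` in the weighted `L²` norm
`‖f‖² = ∫ (1+|ξ|²)|f(ξ)|² dξ`, but no joint measurability in `(t, ξ)` is asked. The uniqueness
argument behind the persistence of `û ≥ 0` integrates in time *and* frequency (Tonelli), so it
needs a jointly measurable representative. This file proves (`exists_measurable_version`):

* there is `Ũ : ℝ → ℝ³ → ℂ`, jointly measurable, with `Ũ(t, ·) = U(t, ·)` a.e. for every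
  `t ∈ [0,1]` (EVERY `t`, not merely a.e. `t`), and
* the weighted norms `∫ (1+|ξ|²)|U(t,ξ)|² dξ` are bounded on `[0,1]`.

Construction: `t ↦ U(t)` is a continuous map of the compact interval into `L²`, hence uniformly
continuous and bounded; the piecewise-constant-in-time approximants `U(⌊t m⌋/m, ·)` are jointly
measurable (countably many measurable slices) and converge to `U(t)` in `L²` uniformly in `t`;
along a fast subsequence they converge a.e. for every `t`
(`MeasureTheory.Lp.ae_tendsto_of_cauchy_eLpNorm`), and
the pointwise `limUnder` is jointly measurable (`StronglyMeasurable.limUnder`) and agrees a.e.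
with `U(t)` (convergence in measure identifies the limit).

## References

* P. G. Lemarié-Rieusset, *The Navier–Stokes Problem in the 21st Century*, CRC 2016, §11.2
  (the class `C([0,T];H¹) ∩ L²((0,T);H²)` of Thm. 11.1). [`LemarieRieusset2016`]
-/

noncomputable section

open MeasureTheory Set Filter Metric Real Function
open scoped ENNReal Topology

namespace Literature.Barriers.NavierStokesRegularity

open Literature.Analysis.FluidPDE.FourierNS

/-- Local notation for frequency space `ℝ³ = EuclideanSpace ℝ (Fin 3)`. -/
local notation "ℝ³" => EuclideanSpace ℝ (Fin 3)

namespace CheapNS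

/-! ### The time grid -/

/-- The grid time `⌊t' (m+1)⌋ / (m+1)`, `t' = t` clamped to `[0,1]`. [folklore] -/
def gridTime (m : ℕ) (t : ℝ) : ℝ := (⌊max 0 (min t 1) * ((m : ℝ) + 1)⌋₊ : ℝ) / ((m : ℝ) + 1)

/-- The grid time lies in `[0, 1]`. [folklore] -/
theorem gridTime_mem (m : ℕ) (t : ℝ) : gridTime m t ∈ Icc (0 : ℝ) 1 := by
  have hm : (0 : ℝ) < (m : ℝ) + 1 := by positivity
  refine ⟨by unfold gridTime; positivity, ?_⟩
  rw [gridTime, div_le_one hm]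
  have h1 : max 0 (min t 1) * ((m : ℝ) + 1) ≤ (m : ℝ) + 1 := by
    have : max 0 (min t 1) ≤ 1 := max_le zero_le_one (min_le_right _ _)
    nlinarith
  calc (⌊max 0 (min t 1) * ((m : ℝ) + 1)⌋₊ : ℝ) ≤ max 0 (min t 1) * ((m : ℝ) + 1) :=
        Nat.floor_le (by positivity)
    _ ≤ (m : ℝ) + 1 := h1

/-- On `[0,1]` the grid time is within `1/(m+1)` of `t`. [folklore] -/
theorem abs_gridTime_sub_le (m : ℕ) {t : ℝ} (ht : t ∈ Icc (0 : ℝ) 1) :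
    |gridTime m t - t| ≤ 1 / ((m : ℝ) + 1) := by
  have hm : (0 : ℝ) < (m : ℝ) + 1 := by positivity
  have hclamp : max 0 (min t 1) = t := by rw [min_eq_left ht.2, max_eq_right ht.1]
  rw [gridTime, hclamp]
  have hx : 0 ≤ t * ((m : ℝ) + 1) := by nlinarith [ht.1]
  have h1 : (⌊t * ((m : ℝ) + 1)⌋₊ : ℝ) / ((m : ℝ) + 1) ≤ t := by
    rw [div_le_iff₀ hm]; exact Nat.floor_le hx
  have h2 : t ≤ (⌊t * ((m : ℝ) + 1)⌋₊ : ℝ) / ((m : ℝ) + 1) + 1 / ((m : ℝ) + 1) := by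
    rw [← add_div, le_div_iff₀ hm]
    exact (Nat.lt_floor_add_one (t * ((m : ℝ) + 1))).le
  rw [abs_sub_comm, abs_of_nonneg (by linarith)]
  linarith

/-- The grid index is measurable in time. [folklore] -/
theorem measurable_gridIndex (m : ℕ) :
    Measurable fun t : ℝ => ⌊max 0 (min t 1) * ((m : ℝ) + 1)⌋₊ :=
  Nat.measurable_floor.comp (by fun_prop)

/-- **The piecewise-constant-in-time approximant is jointly measurable** (countably many
measurable slices). [folklore] -/
theorem measurable_grid_uncurry {U : ℝ → ℝ³ → ℂ} (hm : ∀ t ∈ Icc (0 : ℝ) 1, Measurable (U t))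
    (m : ℕ) : Measurable fun p : ℝ × ℝ³ => U (gridTime m p.1) p.2 := by
  set G : ℕ × ℝ³ → ℂ := fun q => U (min 1 ((q.1 : ℝ) / ((m : ℝ) + 1))) q.2 with hG
  have hGm : Measurable G := by
    refine measurable_from_prod_countable_right fun k => ?_
    exact hm _ ⟨le_min zero_le_one (div_nonneg (Nat.cast_nonneg _) (by positivity)),
      min_le_left _ _⟩
  have heq : (fun p : ℝ × ℝ³ => U (gridTime m p.1) p.2) =
      fun p => G (⌊max 0 (min p.1 1) * ((m : ℝ) + 1)⌋₊, p.2) := by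
    funext p
    simp only [hG]
    rw [min_eq_right]
    · rfl
    · exact (gridTime_mem m p.1).2
  rw [heq]
  exact hGm.comp (((measurable_gridIndex m).comp measurable_fst).prodMk measurable_snd)

/-! ### The weighted slices as elements of `L²` -/

/-- `x² < ∞ → x < ∞` in `ℝ≥0∞`. [folklore] -/
theorem lt_top_of_sq_lt_top {x : ℝ≥0∞} (h : x ^ 2 < ∞) : x < ∞ := by
  by_contra hx
  rw [not_lt, top_le_iff] at hx
  rw [hx] at h
  simp at h

section Version

variable {U : ℝ → ℝ³ → ℂ}

/-- The weighted slice `g(t) = (1+|ξ|²)^{1/2} U(t)`. [folklore] -/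
def wslice (U : ℝ → ℝ³ → ℂ) (t : ℝ) (ξ : ℝ³) : ℂ := ((Real.sqrt (1 + ‖ξ‖ ^ 2) : ℝ) : ℂ) * U t ξ

/-- The weight factor has `‖(1+|ξ|²)^{1/2}‖ₑ = ofReal (1+|ξ|²)^{1/2}`. [folklore] -/
theorem enorm_sqrt_weight (ξ : ℝ³) :
    ‖((Real.sqrt (1 + ‖ξ‖ ^ 2) : ℝ) : ℂ)‖ₑ = ENNReal.ofReal (Real.sqrt (1 + ‖ξ‖ ^ 2)) := by
  rw [← ofReal_norm, Complex.norm_real, Real.norm_of_nonneg (Real.sqrt_nonneg _)]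

/-- `‖g(t,ξ) - g(t',ξ)‖² = (1+|ξ|²) ‖U(t,ξ) - U(t',ξ)‖²`. [folklore] -/
theorem enorm_wslice_sub_sq (U : ℝ → ℝ³ → ℂ) (t t' : ℝ) (ξ : ℝ³) :
    ‖wslice U t ξ - wslice U t' ξ‖ₑ ^ 2 = ENNReal.ofReal (1 + ‖ξ‖ ^ 2) * ‖U t ξ - U t' ξ‖ₑ ^ 2 := by
  rw [wslice, wslice, ← mul_sub, enorm_mul, mul_pow, enorm_sqrt_weight,
    ← ENNReal.ofReal_pow (Real.sqrt_nonneg _), Real.sq_sqrt (by positivity)]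

/-- `‖g(t,ξ)‖² = (1+|ξ|²) ‖U(t,ξ)‖²`. [folklore] -/
theorem enorm_wslice_sq (U : ℝ → ℝ³ → ℂ) (t : ℝ) (ξ : ℝ³) :
    ‖wslice U t ξ‖ₑ ^ 2 = ENNReal.ofReal (1 + ‖ξ‖ ^ 2) * ‖U t ξ‖ₑ ^ 2 := by
  rw [wslice, enorm_mul, mul_pow, enorm_sqrt_weight,
    ← ENNReal.ofReal_pow (Real.sqrt_nonneg _), Real.sq_sqrt (by positivity)]

/-- The unweighted difference is dominated by the weighted one. [folklore] -/
theorem enorm_sub_le_enorm_wslice_sub (U : ℝ → ℝ³ → ℂ) (t t' : ℝ) (ξ : ℝ³) :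
    ‖U t ξ - U t' ξ‖ₑ ≤ ‖wslice U t ξ - wslice U t' ξ‖ₑ := by
  rw [wslice, wslice, ← mul_sub, enorm_mul, enorm_sqrt_weight]
  calc ‖U t ξ - U t' ξ‖ₑ = 1 * ‖U t ξ - U t' ξ‖ₑ := (one_mul _).symm
    _ ≤ ENNReal.ofReal (Real.sqrt (1 + ‖ξ‖ ^ 2)) * ‖U t ξ - U t' ξ‖ₑ := by
        gcongr
        rw [← ENNReal.ofReal_one]
        exact ENNReal.ofReal_le_ofReal (Real.one_le_sqrt.2 (by nlinarith [norm_nonneg ξ]))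

/-- The weighted `L²` distance of two slices is the `L²` distance of the weighted slices:
`eLpNorm (g t - g t') 2 = (∫ (1+|ξ|²)|U t - U t'|²)^{1/2}`. [folklore] -/
theorem eLpNorm_wslice_sub (U : ℝ → ℝ³ → ℂ) (t t' : ℝ) :
    eLpNorm (wslice U t - wslice U t') 2 volume =
      (∫⁻ ξ, ENNReal.ofReal (1 + ‖ξ‖ ^ 2) * ‖U t ξ - U t' ξ‖ₑ ^ 2) ^ (1 / 2 : ℝ) := by
  rw [← lintegral_enorm_sq_rpow_half_eq_eLpNorm]
  congr 1
  exact lintegral_congr fun ξ => enorm_wslice_sub_sq U t t' ξ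

/-- **A jointly measurable version of a slice-wise measurable, `H¹`-continuous trajectory.**
If every slice `U(t)`, `t ∈ [0,1]`, is measurable with finite weighted norm
`∫ (1+|ξ|²)|U(t,ξ)|² dξ`, and `t ↦ U(t)` is continuous on `[0,1]` in that norm, then there is a
jointly measurable `Ũ` with `Ũ(t) = U(t)` a.e. for every `t ∈ [0,1]`, and the weighted norms
are bounded on `[0,1]`. [folklore] -/
theorem exists_measurable_version (hm : ∀ t ∈ Icc (0 : ℝ) 1, Measurable (U t))
    (hH1 : ∀ t ∈ Icc (0 : ℝ) 1, ∫⁻ ξ, ENNReal.ofReal (1 + ‖ξ‖ ^ 2) * ‖U t ξ‖ₑ ^ 2 < ∞)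
    (hcont : ∀ t₀ ∈ Icc (0 : ℝ) 1, Tendsto
      (fun t => ∫⁻ ξ, ENNReal.ofReal (1 + ‖ξ‖ ^ 2) * ‖U t ξ - U t₀ ξ‖ₑ ^ 2)
      (𝓝[Icc (0 : ℝ) 1] t₀) (𝓝 0)) :
    ∃ Ut : ℝ → ℝ³ → ℂ, Measurable (uncurry Ut) ∧ (∀ t ∈ Icc (0 : ℝ) 1, Ut t =ᵐ[volume] U t) ∧
      ∃ R : ℝ≥0∞, R ≠ ∞ ∧
        ∀ t ∈ Icc (0 : ℝ) 1, ∫⁻ ξ, ENNReal.ofReal (1 + ‖ξ‖ ^ 2) * ‖U t ξ‖ₑ ^ 2 ≤ R := by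
  -- the distance functional
  set d : ℝ → ℝ → ℝ≥0∞ := fun t t' =>
    ∫⁻ ξ, ENNReal.ofReal (1 + ‖ξ‖ ^ 2) * ‖U t ξ - U t' ξ‖ₑ ^ 2 with hd
  -- the weighted slices are in `L²`
  have hgm : ∀ t ∈ Icc (0 : ℝ) 1, Measurable (wslice U t) := fun t ht =>
    (Complex.measurable_ofReal.comp (by fun_prop)).mul (hm t ht)
  have hmem : ∀ t ∈ Icc (0 : ℝ) 1, MemLp (wslice U t) 2 volume := by
    intro t ht
    refine ⟨(hgm t ht).aestronglyMeasurable, lt_top_of_sq_lt_top ?_⟩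
    rw [← lintegral_enorm_sq_eq_eLpNorm_sq]
    calc ∫⁻ ξ, ‖wslice U t ξ‖ₑ ^ 2 = ∫⁻ ξ, ENNReal.ofReal (1 + ‖ξ‖ ^ 2) * ‖U t ξ‖ₑ ^ 2 :=
          lintegral_congr fun ξ => enorm_wslice_sq U t ξ
      _ < ∞ := hH1 t ht
  -- the `L²`-valued map
  classical
  set Φ : ℝ → Lp ℂ 2 (volume : Measure ℝ³) := fun t =>
    if ht : t ∈ Icc (0 : ℝ) 1 then (hmem t ht).toLp (wslice U t) else 0 with hΦ
  have hΦt : ∀ {t} (ht : t ∈ Icc (0 : ℝ) 1), Φ t = (hmem t ht).toLp (wslice U t) :=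
    fun ht => dif_pos ht
  have hdist : ∀ {t t'} (ht : t ∈ Icc (0 : ℝ) 1) (ht' : t' ∈ Icc (0 : ℝ) 1),
      ‖Φ t - Φ t'‖ = (d t t' ^ (1 / 2 : ℝ)).toReal := by
    intro t t' ht ht'
    rw [hΦt ht, hΦt ht', ← MemLp.toLp_sub (hmem t ht) (hmem t' ht'), Lp.norm_toLp,
      eLpNorm_wslice_sub]
  have hdfin : ∀ {t t'} (ht : t ∈ Icc (0 : ℝ) 1) (ht' : t' ∈ Icc (0 : ℝ) 1), d t t' ≠ ∞ := by
    intro t t' ht ht'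
    have h := ((hmem t ht).sub (hmem t' ht')).eLpNorm_lt_top
    rw [show wslice U t - wslice U t' = fun ξ => wslice U t ξ - wslice U t' ξ from rfl] at h
    have h2 : d t t' ^ (1 / 2 : ℝ) < ∞ := by
      rw [hd]; simp only
      rw [← eLpNorm_wslice_sub]; exact h
    intro htop
    rw [htop, ENNReal.top_rpow_of_pos (by norm_num)] at h2
    exact lt_irrefl _ h2
  have hdist' : ∀ {t t'} (ht : t ∈ Icc (0 : ℝ) 1) (ht' : t' ∈ Icc (0 : ℝ) 1),
      d t t' ^ (1 / 2 : ℝ) = ENNReal.ofReal ‖Φ t - Φ t'‖ := by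
    intro t t' ht ht'
    rw [hdist ht ht', ENNReal.ofReal_toReal (ENNReal.rpow_ne_top_of_nonneg (by norm_num)
      (hdfin ht ht'))]
  -- continuity on the compact interval
  have hΦc : ContinuousOn Φ (Icc 0 1) := by
    intro t₀ ht₀
    rw [ContinuousWithinAt, tendsto_iff_norm_sub_tendsto_zero]
    have h1 : Tendsto (fun t => (d t t₀ ^ (1 / 2 : ℝ)).toReal) (𝓝[Icc (0 : ℝ) 1] t₀) (𝓝 0) := by
      have h := (hcont t₀ ht₀).ennrpow_const (1 / 2 : ℝ)
      rw [ENNReal.zero_rpow_of_pos (by norm_num)] at h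
      have h' := (ENNReal.tendsto_toReal ENNReal.zero_ne_top).comp h
      rwa [ENNReal.toReal_zero] at h'
    refine h1.congr' (eventually_nhdsWithin_of_forall fun t ht => ?_)
    exact (hdist ht ht₀).symm
  -- boundedness
  obtain ⟨C, hC⟩ := isCompact_Icc.exists_bound_of_continuousOn hΦc
  have hbound : ∀ t ∈ Icc (0 : ℝ) 1,
      ∫⁻ ξ, ENNReal.ofReal (1 + ‖ξ‖ ^ 2) * ‖U t ξ‖ₑ ^ 2 ≤ ENNReal.ofReal C ^ 2 := by
    intro t ht
    have h1 : ∫⁻ ξ, ENNReal.ofReal (1 + ‖ξ‖ ^ 2) * ‖U t ξ‖ₑ ^ 2 =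
        eLpNorm (wslice U t) 2 volume ^ 2 := by
      rw [← lintegral_enorm_sq_eq_eLpNorm_sq]
      exact lintegral_congr fun ξ => (enorm_wslice_sq U t ξ).symm
    have h2 : eLpNorm (wslice U t) 2 volume = ENNReal.ofReal ‖Φ t‖ := by
      rw [hΦt ht, Lp.norm_toLp, ENNReal.ofReal_toReal (hmem t ht).eLpNorm_lt_top.ne]
    rw [h1, h2]
    exact pow_le_pow_left' (ENNReal.ofReal_le_ofReal (hC t ht)) 2
  -- uniform continuity and the fast grid sequence
  have hUC := Metric.uniformContinuousOn_iff.1 (isCompact_Icc.uniformContinuousOn_of_continuous hΦc)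
  set ε : ℕ → ℝ := fun k => (1 / 2 : ℝ) ^ (k + 2) with hε
  have hεpos : ∀ k, 0 < ε k := fun k => by positivity
  choose δ hδpos hδ using fun k => hUC (ε k) (hεpos k)
  set mk : ℕ → ℕ := fun k => ⌈(δ k)⁻¹⌉₊ with hmk
  have hgrid : ∀ k, ∀ t ∈ Icc (0 : ℝ) 1, ‖Φ (gridTime (mk k) t) - Φ t‖ < ε k := by
    intro k t ht
    have h1 : |gridTime (mk k) t - t| < δ k := by
      refine lt_of_le_of_lt (abs_gridTime_sub_le (mk k) ht) ?_
      rw [one_div, inv_lt_comm₀ (by positivity) (hδpos k)]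
      calc (δ k)⁻¹ ≤ ⌈(δ k)⁻¹⌉₊ := Nat.le_ceil _
        _ < (⌈(δ k)⁻¹⌉₊ : ℝ) + 1 := lt_add_one _
    have h2 := hδ k (gridTime (mk k) t) (gridTime_mem _ _) t ht (by rwa [Real.dist_eq])
    rwa [dist_eq_norm] at h2
  -- the approximants and the limit
  set F : ℕ → ℝ × ℝ³ → ℂ := fun k p => U (gridTime (mk k) p.1) p.2 with hF
  have hFm : ∀ k, Measurable (F k) := fun k => measurable_grid_uncurry hm (mk k)
  set Ut : ℝ → ℝ³ → ℂ := fun t ξ => limUnder atTop (fun k => F k (t, ξ)) with hUt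
  have hUtm : Measurable (uncurry Ut) := by
    have h := StronglyMeasurable.limUnder (l := atTop) (f := fun k p => F k p)
      (fun k => (hFm k).stronglyMeasurable)
    exact h.measurable
  refine ⟨Ut, hUtm, fun t ht => ?_, ENNReal.ofReal C ^ 2,
    ENNReal.pow_ne_top ENNReal.ofReal_ne_top, hbound⟩
  -- identification of the limit at a fixed time
  set f : ℕ → ℝ³ → ℂ := fun k => U (gridTime (mk k) t) with hf
  have hfm : ∀ k, Measurable (f k) := fun k => hm _ (gridTime_mem _ _)
  have hfL2 : ∀ k, eLpNorm (f k - U t) 2 volume ≤ ENNReal.ofReal (ε k) := by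
    intro k
    calc eLpNorm (f k - U t) 2 volume
        ≤ eLpNorm (wslice U (gridTime (mk k) t) - wslice U t) 2 volume :=
          eLpNorm_mono_enorm fun ξ => enorm_sub_le_enorm_wslice_sub U _ _ ξ
      _ = d (gridTime (mk k) t) t ^ (1 / 2 : ℝ) := eLpNorm_wslice_sub U _ _
      _ = ENNReal.ofReal ‖Φ (gridTime (mk k) t) - Φ t‖ := hdist' (gridTime_mem _ _) ht
      _ ≤ ENNReal.ofReal (ε k) := ENNReal.ofReal_le_ofReal (hgrid k t ht).le
  -- Cauchy in `L²` with summable bounds: a.e. convergence of the full sequence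
  have hcau : ∀ N n m : ℕ, N ≤ n → N ≤ m →
      eLpNorm (f n - f m) 2 volume < ENNReal.ofReal ((1 / 2 : ℝ) ^ N) := by
    intro N n m hn hm'
    have hle : eLpNorm (f n - f m) 2 volume ≤
        ENNReal.ofReal (‖Φ (gridTime (mk n) t) - Φ t‖ + ‖Φ (gridTime (mk m) t) - Φ t‖) := by
      calc eLpNorm (f n - f m) 2 volume
          ≤ eLpNorm (wslice U (gridTime (mk n) t) - wslice U (gridTime (mk m) t)) 2 volume :=
            eLpNorm_mono_enorm fun ξ => enorm_sub_le_enorm_wslice_sub U _ _ ξ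
        _ = d (gridTime (mk n) t) (gridTime (mk m) t) ^ (1 / 2 : ℝ) := eLpNorm_wslice_sub U _ _
        _ = ENNReal.ofReal ‖Φ (gridTime (mk n) t) - Φ (gridTime (mk m) t)‖ :=
            hdist' (gridTime_mem _ _) (gridTime_mem _ _)
        _ ≤ _ := by
            refine ENNReal.ofReal_le_ofReal ?_
            calc ‖Φ (gridTime (mk n) t) - Φ (gridTime (mk m) t)‖
                = ‖(Φ (gridTime (mk n) t) - Φ t) - (Φ (gridTime (mk m) t) - Φ t)‖ := by
                  congr 1; abel
              _ ≤ _ := norm_sub_le _ _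
    refine lt_of_le_of_lt hle ((ENNReal.ofReal_lt_ofReal_iff (by positivity)).2 ?_)
    have h1 := hgrid n t ht
    have h2 := hgrid m t ht
    have hεn : ε n ≤ (1 / 2 : ℝ) ^ (N + 2) := pow_le_pow_of_le_one (by norm_num) (by norm_num) (by omega)
    have hεm : ε m ≤ (1 / 2 : ℝ) ^ (N + 2) := pow_le_pow_of_le_one (by norm_num) (by norm_num) (by omega)
    have hid : (1 / 2 : ℝ) ^ (N + 2) + (1 / 2 : ℝ) ^ (N + 2) = (1 / 2 : ℝ) ^ N / 2 := by ring
    have hpos : (0 : ℝ) < (1 / 2 : ℝ) ^ N := by positivity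
    linarith
  have hB : ∑' N : ℕ, ENNReal.ofReal ((1 / 2 : ℝ) ^ N) ≠ ∞ := by
    rw [← ENNReal.ofReal_tsum_of_nonneg (fun N => by positivity) summable_geometric_two]
    exact ENNReal.ofReal_ne_top
  have hlim : ∀ᵐ ξ : ℝ³, ∃ l : ℂ, Tendsto (fun k => f k ξ) atTop (𝓝 l) :=
    MeasureTheory.Lp.ae_tendsto_of_cauchy_eLpNorm (fun k => (hfm k).aestronglyMeasurable) (by norm_num) hB hcau
  -- convergence in measure to `U t` identifies the limit
  have hεlim : Tendsto (fun k => ENNReal.ofReal (ε k)) atTop (𝓝 0) := by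
    rw [← ENNReal.ofReal_zero]
    refine ENNReal.tendsto_ofReal ?_
    have h := (tendsto_pow_atTop_nhds_zero_of_lt_one (by norm_num : (0 : ℝ) ≤ 1 / 2)
      (by norm_num)).comp (tendsto_add_atTop_nat 2)
    exact h
  have hL2 : Tendsto (fun k => eLpNorm (f k - U t) 2 volume) atTop (𝓝 0) :=
    tendsto_of_tendsto_of_tendsto_of_le_of_le tendsto_const_nhds hεlim (fun k => zero_le) hfL2
  have hmeas : TendstoInMeasure volume f atTop (U t) :=
    tendstoInMeasure_of_tendsto_eLpNorm (by norm_num) (fun k => (hfm k).aestronglyMeasurable)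
      (hm t ht).aestronglyMeasurable hL2
  obtain ⟨ns, hns, hsub⟩ := hmeas.exists_seq_tendsto_ae
  filter_upwards [hlim, hsub] with ξ hξ hξ'
  obtain ⟨l, hl⟩ := hξ
  have h1 : Ut t ξ = l := hl.limUnder_eq
  have h2 : Tendsto (fun i => f (ns i) ξ) atTop (𝓝 l) := hl.comp hns.tendsto_atTop
  rw [h1]
  exact tendsto_nhds_unique h2 hξ'

end Version

end CheapNS

end Literature.Barriers.NavierStokesRegularity

end
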